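import Literature.AlgebraicTopology.FundamentalGroup.PunctureIndependence
import Mathlib.GroupTheory.FreeGroup.GeneratorEquiv
import HarnessLib

/-!
# Puncture independence with ranks: `rank π₁(M ∖ (S ∪ T)) = rank π₁(M ∖ S) + |T|`

Topic `Literature/AlgebraicTopology/FundamentalGroup`; sequel of `PunctureIndependence` (freeness of
`π₁(M ∖ S)` of finite rank does not depend on the finite non-empty puncture set `S`) and
`FreeProductIntRank` (`F_n ∗ ℤ ≅ F_{n+1}`).  For a connected Hausdorff surface `M` (a `ChartedSpace ℂ M`;
no smooth or complex structure is used), the classical computation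

> a compact orientable surface of genus `g` with `r ≥ 1` points removed has free fundamental group of
> rank `2g + r − 1` (W. S. Massey, *Algebraic Topology: An Introduction* (1967), Ch. 4 §5; A. Hatcher,
> *Algebraic Topology* (2002), §1.2 Example 1.22: `ℝ² ∖ {n points}` has `π₁` free of rank `n`)

says in particular that EACH FURTHER PUNCTURE RAISES THE RANK BY ONE.  This file proves that
bookkeeping statement for an arbitrary connected Hausdorff surface, so that the rank computed for ONE
finite puncture set (in the sequel `PuncturedCompactRiemannSurfacePi1Rank`, from a branched cover of the
sphere) propagates to all of them:

* §0 rank bookkeeping for free groups: `FreeGroup (Fin n) ≃* FreeGroup (Fin m) → n = m` (Mathlib's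
  `Equiv.ofFreeGroupEquiv`), `G ≃* F_n → G ∗ ℤ ≃* F_{n+1}`, and conversely
  `G ∗ ℤ ≃* F_m → ∃ n, m = n + 1 ∧ G ≃* F_n`;
* §1 **`HasFreePiRank S n`** — `π₁(M ∖ S, x) ≃* F_n` at every base point (one base point suffices,
  `hasFreePiRank_of_exists`; the rank is unique, `HasFreePiRank.unique`);
* §2 the local step **`hasFreePiRank_insert_insert_iff`** (two punctures in one chart:
  `HasFreePiRank (S ∪ {p, q}) n ↔ ∃ m, n = m + 1 ∧ HasFreePiRank (S ∪ {p}) m`, from the tree's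
  `ChartSegment.nonempty_mulEquiv_coprod_int`), local constancy and **`hasFreePiRank_insert_iff_insert`**
  (moving one puncture keeps the rank), **`hasFreePiRank_insert_iff`** / `hasFreePiRank_insert_succ_iff`
  (adding one puncture adds one to the rank), **`hasFreePiRank_union_iff`** (adding a finite disjoint
  `T` adds `|T|`), and the two-puncture-set form **`HasFreePiRank.add_ncard_eq`**
  (`n + |S'| = n' + |S|`) with its transfer version **`HasFreePiRank.exists_of_compl`**.

Everything is proved; one definition (the predicate `HasFreePiRank`), no instances, no named facts.

## References
* W. S. Massey, *Algebraic Topology: An Introduction*, GTM 56 (1967/1977), Ch. 4 §5.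
  [Massey1967AlgebraicTopology]
* A. Hatcher, *Algebraic Topology*, CUP (2002), §1.2 Example 1.22, §1.A (bases and rank of free
  groups), Prop. 1.5 (change of base point). [HatcherAT2002]
-/

noncomputable section

open Set Function Metric
open scoped Topology

namespace Literature.AlgebraicTopology.FundamentalGroup

universe u v

/-! ### §0 Rank bookkeeping for free groups -/

section FreeGroups

/-- **Rank invariance**: `F_n ≅ F_m` forces `n = m` (Mathlib's `Equiv.ofFreeGroupEquiv`, through the
abelianisations). [cite: HatcherAT2002, §1.A (free groups: bases and rank)] -/
theorem eq_of_freeGroup_fin_mulEquiv {n m : ℕ} (e : FreeGroup (Fin n) ≃* FreeGroup (Fin m)) : n = m := by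
  simpa using Fintype.card_congr (Equiv.ofFreeGroupEquiv e)

/-- The rank of a group free of finite rank is well defined. [cite: HatcherAT2002, §1.A (free groups: bases and rank)] -/
theorem eq_of_mulEquiv_freeGroup_fin {G : Type u} [Group G] {n m : ℕ} (e₁ : G ≃* FreeGroup (Fin n))
    (e₂ : G ≃* FreeGroup (Fin m)) : n = m :=
  eq_of_freeGroup_fin_mulEquiv (e₁.symm.trans e₂)

/-- `G ≅ F_n ⇒ G ∗ ℤ ≅ F_{n+1}`. [cite: HatcherAT2002, §1.2 (free products)] -/
theorem nonempty_coprod_int_mulEquiv_freeGroup {G : Type u} [Group G] {n : ℕ}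
    (e : G ≃* FreeGroup (Fin n)) :
    Nonempty (Monoid.Coprod G (Multiplicative ℤ) ≃* FreeGroup (Fin (n + 1))) := by
  obtain ⟨f⟩ := nonempty_freeGroup_fin_coprod_int_mulEquiv n
  exact ⟨(MulEquiv.coprodCongr e (MulEquiv.refl _)).trans f⟩

/-- `G ∗ ℤ ≅ F_m ⇒ m = n + 1` with `G ≅ F_n` (`G` is a free factor, hence free of finite rank `n`, and
`F_m ≅ G ∗ ℤ ≅ F_{n+1}`). [cite: HatcherAT2002, §1.2 and Thm. 1A.4 (Nielsen–Schreier)] -/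
theorem exists_mulEquiv_freeGroup_of_coprod_int {G : Type u} [Group G] {m : ℕ}
    (e : Monoid.Coprod G (Multiplicative ℤ) ≃* FreeGroup (Fin m)) :
    ∃ n, m = n + 1 ∧ Nonempty (G ≃* FreeGroup (Fin n)) := by
  obtain ⟨n, ⟨f⟩⟩ := (isFreeOfFiniteRank_coprod_int_iff G).1 ⟨m, ⟨e⟩⟩
  obtain ⟨g⟩ := nonempty_coprod_int_mulEquiv_freeGroup f
  exact ⟨n, eq_of_mulEquiv_freeGroup_fin e g, ⟨f⟩⟩

/-- `G ∗ ℤ ≅ F_m ↔ (m = n + 1 ∧ G ≅ F_n for some n)`. [cite: HatcherAT2002, §1.2 and Thm. 1A.4 (Nielsen–Schreier)] -/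
theorem nonempty_coprod_int_mulEquiv_freeGroup_iff (G : Type u) [Group G] (m : ℕ) :
    Nonempty (Monoid.Coprod G (Multiplicative ℤ) ≃* FreeGroup (Fin m)) ↔
      ∃ n, m = n + 1 ∧ Nonempty (G ≃* FreeGroup (Fin n)) := by
  constructor
  · rintro ⟨e⟩
    exact exists_mulEquiv_freeGroup_of_coprod_int e
  · rintro ⟨n, rfl, ⟨f⟩⟩
    exact nonempty_coprod_int_mulEquiv_freeGroup f

end FreeGroups

/-! ### §1 The rank of `π₁(M ∖ S)` -/

section Rank

variable {M : Type u} [TopologicalSpace M]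

/-- **`HasFreePiRank S n`**: `π₁(M ∖ S, x) ≅ F_n` at every base point `x ∈ M ∖ S` (the quantity computed
for punctured surfaces in Massey Ch. 4 §5 / Hatcher Example 1.22). [cite: Massey1967AlgebraicTopology, Ch. 4 §5] -/
def HasFreePiRank (S : Set M) (n : ℕ) : Prop :=
  ∀ x : ↥(Sᶜ : Set M), Nonempty (_root_.FundamentalGroup ↥(Sᶜ : Set M) x ≃* FreeGroup (Fin n))

/-- Unfolding. [cite: Massey1967AlgebraicTopology, Ch. 4 §5] -/
theorem hasFreePiRank_iff (S : Set M) (n : ℕ) :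
    HasFreePiRank S n ↔
      ∀ x : ↥(Sᶜ : Set M), Nonempty (_root_.FundamentalGroup ↥(Sᶜ : Set M) x ≃* FreeGroup (Fin n)) :=
  Iff.rfl

/-- With a path connected complement, one base point suffices. [cite: HatcherAT2002, Prop. 1.5] -/
theorem hasFreePiRank_of_exists {S : Set M} {n : ℕ} (hS : IsPathConnected Sᶜ)
    (h : ∃ x : ↥(Sᶜ : Set M), Nonempty (_root_.FundamentalGroup ↥(Sᶜ : Set M) x ≃* FreeGroup (Fin n))) :
    HasFreePiRank S n := by
  obtain ⟨x, ⟨e⟩⟩ := h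
  haveI : PathConnectedSpace ↥(Sᶜ : Set M) := isPathConnected_iff_pathConnectedSpace.1 hS
  intro y
  exact ⟨(_root_.FundamentalGroup.fundamentalGroupMulEquivOfPathConnected y x).trans e⟩

/-- A free `π₁` of rank `n` is free of finite rank. [cite: HatcherAT2002, §1.A (free groups: bases and rank)] -/
theorem HasFreePiRank.isFreeOfFiniteRank {S : Set M} {n : ℕ} (h : HasFreePiRank S n)
    (x : ↥(Sᶜ : Set M)) :
    Literature.IUT.HodgeTheaters.IsFreeOfFiniteRank (_root_.FundamentalGroup ↥(Sᶜ : Set M) x) :=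
  ⟨n, h x⟩

/-- **The rank is unique** (as soon as `M ∖ S` has a point). [cite: HatcherAT2002, §1.A (free groups: bases and rank)] -/
theorem HasFreePiRank.unique {S : Set M} {n m : ℕ} (hn : HasFreePiRank S n) (hm : HasFreePiRank S m)
    (hne : (Sᶜ : Set M).Nonempty) : n = m := by
  obtain ⟨x, hx⟩ := hne
  obtain ⟨e₁⟩ := hn ⟨x, hx⟩
  obtain ⟨e₂⟩ := hm ⟨x, hx⟩
  exact eq_of_mulEquiv_freeGroup_fin e₁ e₂

/-- From freeness of finite rank at one base point of a path connected complement, SOME rank.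
[cite: HatcherAT2002, Prop. 1.5] -/
theorem exists_hasFreePiRank_of_isFreeOfFiniteRank {S : Set M} (hS : IsPathConnected Sᶜ)
    (x : ↥(Sᶜ : Set M))
    (hx : Literature.IUT.HodgeTheaters.IsFreeOfFiniteRank (_root_.FundamentalGroup ↥(Sᶜ : Set M) x)) :
    ∃ n, HasFreePiRank S n := by
  obtain ⟨n, hn⟩ := hx
  exact ⟨n, hasFreePiRank_of_exists hS ⟨x, hn⟩⟩

/-- Transport of the rank along a homeomorphism of complements. [cite: HatcherAT2002, Prop. 1.5 (and functoriality of `π₁`)] -/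
theorem HasFreePiRank.of_homeomorph {M' : Type v} [TopologicalSpace M'] {S : Set M} {S' : Set M'}
    {n : ℕ} (h : HasFreePiRank S n) (φ : ↥(S'ᶜ : Set M') ≃ₜ ↥(Sᶜ : Set M)) : HasFreePiRank S' n := by
  intro x
  obtain ⟨e⟩ := h (φ x)
  exact ⟨(φ.fundamentalGroupMulEquiv (x := x) (y := φ x) rfl).trans e⟩

end Rank

/-! ### §2 Puncture independence with ranks -/

section Independence

variable {M : Type u} [TopologicalSpace M] [T2Space M] [ConnectedSpace M] [ChartedSpace ℂ M]

/-- **The local step**: for `q ≠ p` in a chart ball about `p` avoiding the finite set `S`,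
`π₁(M ∖ (S ∪ {p, q})) ≅ π₁(M ∖ (S ∪ {p})) ∗ ℤ` (`ChartSegment.nonempty_mulEquiv_coprod_int`), so
`HasFreePiRank (S ∪ {p, q}) n ↔ ∃ m, n = m + 1 ∧ HasFreePiRank (S ∪ {p}) m`.
[cite: HatcherAT2002, §1.2 Example 1.22] -/
theorem hasFreePiRank_insert_insert_iff {S : Set M} (hS : S.Finite) {p q : M} {R : ℝ}
    (hq : q ∈ (chartAt ℂ p).source) (hpq : p ≠ q)
    (hRt : ball (chartAt ℂ p p) R ⊆ (chartAt ℂ p).target) (hqR : chartAt ℂ p q ∈ ball (chartAt ℂ p p) R)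
    (hdisj : Disjoint S ((chartAt ℂ p).source ∩ chartAt ℂ p ⁻¹' ball (chartAt ℂ p p) R)) (n : ℕ) :
    HasFreePiRank (insert p (insert q S)) n ↔ ∃ m, n = m + 1 ∧ HasFreePiRank (insert p S) m := by
  have hps : p ∈ (chartAt ℂ p).source := mem_chart_source ℂ p
  have hU := PunctureIndependence.isPathConnected_compl_union_chartSegment hS hq hpq hRt hqR hdisj
  have h2 := ChartSegment.isPathConnected_compl_insert_insert hps hq hpq hRt hqR hS.isClosed hdisj hU
  have h1 := ChartSegment.isPathConnected_compl_insert hps hq hpq hRt hqR hS.isClosed hdisj hU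
  obtain ⟨x⟩ := h2.nonempty.to_subtype
  obtain ⟨y⟩ := h1.nonempty.to_subtype
  obtain ⟨E⟩ := ChartSegment.nonempty_mulEquiv_coprod_int hps hq hpq hRt hqR hS.isClosed hdisj hU x y
  constructor
  · intro h
    obtain ⟨f⟩ := h x
    obtain ⟨m, hm, ⟨g⟩⟩ := exists_mulEquiv_freeGroup_of_coprod_int (E.symm.trans f)
    exact ⟨m, hm, hasFreePiRank_of_exists h1 ⟨y, ⟨g⟩⟩⟩
  · rintro ⟨m, rfl, h⟩
    obtain ⟨g⟩ := h y
    obtain ⟨f⟩ := nonempty_coprod_int_mulEquiv_freeGroup g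
    exact hasFreePiRank_of_exists h2 ⟨x, ⟨E.trans f⟩⟩

omit [T2Space M] [ConnectedSpace M] [ChartedSpace ℂ M] in
/-- From two local steps sharing the larger puncture set: the smaller ones have the same ranks.
[cite: HatcherAT2002, §1.2 Example 1.22 (method)] -/
theorem hasFreePiRank_iff_of_forall_iff_exists {S₁ S₂ : Set M} {P : ℕ → Prop}
    (h₁ : ∀ n, P n ↔ ∃ m, n = m + 1 ∧ HasFreePiRank S₁ m)
    (h₂ : ∀ n, P n ↔ ∃ m, n = m + 1 ∧ HasFreePiRank S₂ m) (k : ℕ) :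
    HasFreePiRank S₁ k ↔ HasFreePiRank S₂ k := by
  have A : (∃ m, k + 1 = m + 1 ∧ HasFreePiRank S₁ m) ↔ ∃ m, k + 1 = m + 1 ∧ HasFreePiRank S₂ m :=
    (h₁ (k + 1)).symm.trans (h₂ (k + 1))
  constructor
  · intro h
    obtain ⟨m, hm, h'⟩ := A.1 ⟨k, rfl, h⟩
    obtain rfl : k = m := Nat.succ_injective hm
    exact h'
  · intro h
    obtain ⟨m, hm, h'⟩ := A.2 ⟨k, rfl, h⟩
    obtain rfl : k = m := Nat.succ_injective hm
    exact h'

/-- **Local constancy**: for `S` finite, `p ↦ (n ↦ HasFreePiRank (S ∪ {p}) n)` is locally constant on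
`M ∖ S`. [cite: HatcherAT2002, §1.2 Example 1.22 (method)] -/
theorem hasFreePiRank_insert_eventually_eq {S : Set M} (hS : S.Finite) {p : M} (hp : p ∉ S) :
    ∀ᶠ q in 𝓝 p, (fun n => HasFreePiRank (insert q S) n) = fun n => HasFreePiRank (insert p S) n := by
  obtain ⟨R, hR, hRt, hdisj⟩ := PunctureIndependence.exists_chartBall_disjoint hS hp
  set e := chartAt ℂ p
  have hps : p ∈ e.source := mem_chart_source ℂ p
  have hV : e.source ∩ e ⁻¹' ball (e p) (R / 2) ∈ 𝓝 p :=
    (e.isOpen_inter_preimage isOpen_ball).mem_nhds ⟨hps, mem_ball_self (half_pos hR)⟩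
  filter_upwards [hV] with q hq
  by_cases hqp : q = p
  · rw [hqp]
  have hqs : q ∈ e.source := hq.1
  have hqR : e q ∈ ball (e p) R := ball_subset_ball (by linarith) hq.2
  -- first local step: chart at `p`, pair `(p, q)`
  have A := hasFreePiRank_insert_insert_iff hS hqs (Ne.symm hqp) hRt hqR hdisj
  -- second local step: SAME chart, pair `(q, p)` with the ball of radius `R/2` about `e q`
  have hball : ball (e q) (R / 2) ⊆ ball (e p) R := by
    intro z hz
    rw [mem_ball] at hz ⊢
    have := mem_ball.1 hq.2
    calc dist z (e p) ≤ dist z (e q) + dist (e q) (e p) := dist_triangle _ _ _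
      _ < R / 2 + R / 2 := add_lt_add hz this
      _ = R := by ring
  have hpR : e p ∈ ball (e q) (R / 2) := by rw [mem_ball, dist_comm]; exact mem_ball.1 hq.2
  have hsub : e.source ∩ e ⁻¹' ball (e q) (R / 2) ⊆ e.source ∩ e ⁻¹' ball (e p) R :=
    fun y hy => ⟨hy.1, hball hy.2⟩
  have hdisj' : Disjoint S (e.source ∩ e ⁻¹' ball (e q) (R / 2)) := hdisj.mono_right hsub
  have hU : IsPathConnected (S ∪ (e.source ∩ e ⁻¹' segment ℝ (e p) (e q)))ᶜ :=
    PunctureIndependence.isPathConnected_compl_union_chartSegment (M := M) hS hqs (Ne.symm hqp) hRt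
      hqR hdisj
  have hUq : IsPathConnected (S ∪ (e.source ∩ e ⁻¹' segment ℝ (e q) (e p)))ᶜ := by
    rw [segment_symm]; exact hU
  have h2 := ChartSegment.isPathConnected_compl_insert_insert hqs hps hqp (hball.trans hRt) hpR
    hS.isClosed hdisj' hUq
  have h1 := ChartSegment.isPathConnected_compl_insert hqs hps hqp (hball.trans hRt) hpR
    hS.isClosed hdisj' hUq
  obtain ⟨x⟩ := h2.nonempty.to_subtype
  obtain ⟨y⟩ := h1.nonempty.to_subtype
  obtain ⟨E⟩ := ChartSegment.nonempty_mulEquiv_coprod_int hqs hps hqp (hball.trans hRt) hpR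
    hS.isClosed hdisj' hUq x y
  have B : ∀ n, HasFreePiRank (insert q (insert p S)) n ↔ ∃ m, n = m + 1 ∧ HasFreePiRank (insert q S) m := by
    intro n
    constructor
    · intro h
      obtain ⟨f⟩ := h x
      obtain ⟨m, hm, ⟨g⟩⟩ := exists_mulEquiv_freeGroup_of_coprod_int (E.symm.trans f)
      exact ⟨m, hm, hasFreePiRank_of_exists h1 ⟨y, ⟨g⟩⟩⟩
    · rintro ⟨m, rfl, h⟩
      obtain ⟨g⟩ := h y
      obtain ⟨f⟩ := nonempty_coprod_int_mulEquiv_freeGroup g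
      exact hasFreePiRank_of_exists h2 ⟨x, ⟨E.trans f⟩⟩
  have B' : ∀ n, HasFreePiRank (insert p (insert q S)) n ↔
      ∃ m, n = m + 1 ∧ HasFreePiRank (insert q S) m := by
    intro n; rw [Set.insert_comm]; exact B n
  funext k
  exact propext (hasFreePiRank_iff_of_forall_iff_exists B' A k)

/-- **Moving one puncture keeps the rank**: for `S` finite and `p, q ∉ S`,
`HasFreePiRank (S ∪ {p}) n ↔ HasFreePiRank (S ∪ {q}) n` (local constancy on the connected `M ∖ S`).
[cite: HatcherAT2002, §1.2 Example 1.22 (method)] -/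
theorem hasFreePiRank_insert_iff_insert {S : Set M} (hS : S.Finite) {p q : M} (hp : p ∉ S)
    (hq : q ∉ S) (n : ℕ) : HasFreePiRank (insert p S) n ↔ HasFreePiRank (insert q S) n := by
  let g : ↥(Sᶜ : Set M) → ℕ → Prop := fun y k => HasFreePiRank (insert (y : M) S) k
  have hg : IsLocallyConstant g := by
    rw [IsLocallyConstant.iff_eventually_eq]
    intro y
    have := hasFreePiRank_insert_eventually_eq hS (p := (y : M)) y.2
    exact continuous_subtype_val.continuousAt.eventually this
  have hSc : IsPreconnected (Sᶜ : Set M) :=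
    (PunctureIndependence.isPathConnected_compl_finite hS ⟨p, hp⟩).isConnected.isPreconnected
  haveI : PreconnectedSpace ↥(Sᶜ : Set M) := Subtype.preconnectedSpace hSc
  have := hg.apply_eq_of_isPreconnected isPreconnected_univ (x := ⟨p, hp⟩) (y := ⟨q, hq⟩)
    (mem_univ _) (mem_univ _)
  exact Iff.of_eq (congrFun this n)

/-- **Adding one puncture adds one to the rank**: for `S` finite non-empty and `q ∉ S`,
`HasFreePiRank (S ∪ {q}) n ↔ ∃ m, n = m + 1 ∧ HasFreePiRank S m`. [cite: Massey1967AlgebraicTopology, Ch. 4 §5] -/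
theorem hasFreePiRank_insert_iff {S : Set M} (hS : S.Finite) (hSne : S.Nonempty) {q : M} (hq : q ∉ S)
    (n : ℕ) : HasFreePiRank (insert q S) n ↔ ∃ m, n = m + 1 ∧ HasFreePiRank S m := by
  obtain ⟨s, hs⟩ := hSne
  set S₀ := S \ {s} with hS₀
  have hS₀f : S₀.Finite := hS.subset Set.sdiff_subset
  have hsS₀ : s ∉ S₀ := fun h => h.2 rfl
  have hSeq : S = insert s S₀ := by
    ext x; by_cases hx : x = s <;> simp [hS₀, hx, hs]
  obtain ⟨R, hR, hRt, hdisj⟩ := PunctureIndependence.exists_chartBall_disjoint hS₀f hsS₀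
  obtain ⟨p, hps, hpsrc, hpR⟩ := PunctureIndependence.exists_ne_mem_chartBall hR hRt
  have hpS₀ : p ∉ S₀ := fun h => hdisj.le_bot ⟨h, hpsrc, hpR⟩
  have hpS : p ∉ S := by rw [hSeq]; exact fun h => h.elim hps hpS₀
  -- `HasFreePiRank (S₀ ∪ {s, p}) n ↔ ∃ m, n = m + 1 ∧ HasFreePiRank (S₀ ∪ {s}) m`
  have A := hasFreePiRank_insert_insert_iff hS₀f hpsrc (Ne.symm hps) hRt hpR hdisj n
  -- `HasFreePiRank (S ∪ {p}) n ↔ HasFreePiRank (S ∪ {q}) n`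
  have B := hasFreePiRank_insert_iff_insert hS hpS hq n
  rw [hSeq, Set.insert_comm] at B
  rw [hSeq]
  exact B.symm.trans A

/-- **Adding one puncture**, successor form: `HasFreePiRank (S ∪ {q}) (n + 1) ↔ HasFreePiRank S n`.
[cite: Massey1967AlgebraicTopology, Ch. 4 §5] -/
theorem hasFreePiRank_insert_succ_iff {S : Set M} (hS : S.Finite) (hSne : S.Nonempty) {q : M}
    (hq : q ∉ S) (n : ℕ) : HasFreePiRank (insert q S) (n + 1) ↔ HasFreePiRank S n := by
  rw [hasFreePiRank_insert_iff hS hSne hq]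
  constructor
  · rintro ⟨m, hm, h⟩
    obtain rfl : n = m := Nat.succ_injective hm
    exact h
  · intro h
    exact ⟨n, rfl, h⟩

/-- With at least two punctures the rank is positive (`π₁` has a free factor `ℤ`).
[cite: Massey1967AlgebraicTopology, Ch. 4 §5] -/
theorem HasFreePiRank.pos {S : Set M} (hS : S.Finite) (hSne : S.Nonempty) {q : M} (hq : q ∉ S)
    {n : ℕ} (h : HasFreePiRank (insert q S) n) : 0 < n := by
  obtain ⟨m, rfl, -⟩ := (hasFreePiRank_insert_iff hS hSne hq n).1 h
  exact Nat.succ_pos m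

/-- **Adding finitely many punctures adds their number to the rank**: for `S` finite non-empty and
`T` finite disjoint from `S`, `HasFreePiRank (S ∪ T) n ↔ ∃ m, n = m + |T| ∧ HasFreePiRank S m`.
[cite: Massey1967AlgebraicTopology, Ch. 4 §5] -/
theorem hasFreePiRank_union_iff {S : Set M} (hS : S.Finite) (hSne : S.Nonempty) {T : Set M}
    (hT : T.Finite) (hST : Disjoint S T) (n : ℕ) :
    HasFreePiRank (S ∪ T) n ↔ ∃ m, n = m + T.ncard ∧ HasFreePiRank S m := by
  induction T, hT using Set.Finite.induction_on generalizing n with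
  | empty =>
    simp only [union_empty, ncard_empty, add_zero, exists_eq_left']
  | @insert q T₀ hq hT₀ ih =>
    have hqS : q ∉ S := fun h => hST.le_bot ⟨h, mem_insert q T₀⟩
    have hST₀ : Disjoint S T₀ := hST.mono_right (subset_insert q T₀)
    have hq' : q ∉ S ∪ T₀ := fun h => h.elim hqS hq
    rw [union_insert, ncard_insert_of_notMem hq hT₀,
      hasFreePiRank_insert_iff (hS.union hT₀) (hSne.mono subset_union_left) hq']
    constructor
    · rintro ⟨m, rfl, hm⟩
      obtain ⟨k, rfl, hk⟩ := (ih hST₀ m).1 hm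
      exact ⟨k, by ring, hk⟩
    · rintro ⟨k, rfl, hk⟩
      exact ⟨k + T₀.ncard, by ring, (ih hST₀ _).2 ⟨k, rfl, hk⟩⟩

/-- **Adding finitely many punctures**, additive form: `HasFreePiRank (S ∪ T) (n + |T|) ↔ HasFreePiRank S n`.
[cite: Massey1967AlgebraicTopology, Ch. 4 §5] -/
theorem hasFreePiRank_union_add_iff {S : Set M} (hS : S.Finite) (hSne : S.Nonempty) {T : Set M}
    (hT : T.Finite) (hST : Disjoint S T) (n : ℕ) :
    HasFreePiRank (S ∪ T) (n + T.ncard) ↔ HasFreePiRank S n := by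
  rw [hasFreePiRank_union_iff hS hSne hT hST]
  constructor
  · rintro ⟨m, hm, h⟩
    obtain rfl : n = m := Nat.add_right_cancel hm
    exact h
  · intro h
    exact ⟨n, rfl, h⟩

/-- **Transfer between two puncture sets**: if `π₁(M ∖ S')` is free of rank `n'`, then `π₁(M ∖ S)` is
free of the rank `n` with `n + |S'| = n' + |S|`, for all finite non-empty `S, S' ⊆ M`.
[cite: Massey1967AlgebraicTopology, Ch. 4 §5] -/
theorem HasFreePiRank.exists_of_compl {S S' : Set M} (hS : S.Finite) (hSne : S.Nonempty)
    (hS' : S'.Finite) (hS'ne : S'.Nonempty) {n' : ℕ} (h' : HasFreePiRank S' n') :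
    ∃ n, HasFreePiRank S n ∧ n + S'.ncard = n' + S.ncard := by
  -- up from `S'` to `U = S' ∪ (S ∖ S')`
  have hU₁ : HasFreePiRank (S' ∪ S \ S') (n' + (S \ S').ncard) :=
    (hasFreePiRank_union_add_iff hS' hS'ne (hS.subset Set.sdiff_subset) disjoint_sdiff_right n').2 h'
  -- `U = S ∪ (S' ∖ S)`; down from `U` to `S`
  have hUeq : S' ∪ S \ S' = S ∪ S' \ S := by
    rw [Set.union_sdiff_self, Set.union_sdiff_self, union_comm]
  rw [hUeq] at hU₁
  obtain ⟨m, hm, hSm⟩ :=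
    (hasFreePiRank_union_iff hS hSne (hS'.subset Set.sdiff_subset) disjoint_sdiff_right _).1 hU₁
  refine ⟨m, hSm, ?_⟩
  have h₁ := Set.ncard_inter_add_ncard_sdiff_eq_ncard S S' hS
  have h₂ := Set.ncard_inter_add_ncard_sdiff_eq_ncard S' S hS'
  rw [Set.inter_comm] at h₂
  omega

/-- **Two puncture sets, two ranks**: `n + |S'| = n' + |S|`. [cite: Massey1967AlgebraicTopology, Ch. 4 §5] -/
theorem HasFreePiRank.add_ncard_eq {S S' : Set M} (hS : S.Finite) (hSne : S.Nonempty)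
    (hS' : S'.Finite) (hS'ne : S'.Nonempty) {n n' : ℕ} (h : HasFreePiRank S n)
    (h' : HasFreePiRank S' n') : n + S'.ncard = n' + S.ncard := by
  obtain ⟨m, hm, hmeq⟩ := h'.exists_of_compl hS hSne hS' hS'ne
  -- `M ∖ S` has a point: `M` is infinite (a chart ball about a point of `S` has a second point, and a
  -- connected Hausdorff space with two points is infinite)
  obtain ⟨s, hs⟩ := hSne
  obtain ⟨R, hR, hRt, -⟩ :=
    PunctureIndependence.exists_chartBall_disjoint (Set.finite_empty) (Set.notMem_empty s)
  obtain ⟨p, hps, -, -⟩ := PunctureIndependence.exists_ne_mem_chartBall hR hRt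
  haveI : Nontrivial M := ⟨⟨p, s, hps⟩⟩
  haveI : Infinite M := PreconnectedSpace.infinite
  have hne : (Sᶜ : Set M).Nonempty := hS.infinite_compl.nonempty
  rw [h.unique hm hne]
  exact hmeq

/-- **Puncture independence with ranks, base-point form**: if `π₁(M ∖ S', x) ≅ F_{n'}` for ONE finite
non-empty `S'` and one base point, then for EVERY finite non-empty `S` and every base point
`π₁(M ∖ S, y) ≅ F_n` with `n + |S'| = n' + |S|`. [cite: Massey1967AlgebraicTopology, Ch. 4 §5] -/
theorem exists_mulEquiv_freeGroup_compl_of_compl {S S' : Set M} (hS : S.Finite) (hSne : S.Nonempty)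
    (hS' : S'.Finite) (hS'ne : S'.Nonempty) (x : ↥(S'ᶜ : Set M)) {n' : ℕ}
    (hx : Nonempty (_root_.FundamentalGroup ↥(S'ᶜ : Set M) x ≃* FreeGroup (Fin n'))) :
    ∃ n, n + S'.ncard = n' + S.ncard ∧
      ∀ y : ↥(Sᶜ : Set M), Nonempty (_root_.FundamentalGroup ↥(Sᶜ : Set M) y ≃* FreeGroup (Fin n)) := by
  have h' : HasFreePiRank S' n' :=
    hasFreePiRank_of_exists (PunctureIndependence.isPathConnected_compl_finite hS' ⟨x, x.2⟩) ⟨x, hx⟩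
  obtain ⟨n, hn, hneq⟩ := h'.exists_of_compl hS hSne hS' hS'ne
  exact ⟨n, hneq, hn⟩

end Independence

end Literature.AlgebraicTopology.FundamentalGroup

end
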